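import Summits.QuantumFields.YangMills.Theorems.FluctuationComparisonRegPrIntLS2BetaChartContDescend
import Summits.QuantumFields.YangMills.Theorems.FluctuationComparisonRegPrIntLS2BetaChartContClosedProfile
import Summits.QuantumFields.YangMills.Theorems.FluctuationComparisonRegPrIntLS2BetaResidualGauge
import HarnessLib

/-!
# CHART∞ · V-c2 (LINE g18-1 `semiclassical_s2beta`, organ S2β, LAPLACE row): THE WINDOW CHART OF RECORD on `histGood`, with the closed-profile Jacobian

Cell `ym3-torus` (rung R3: continuum `SU(2)` Yang–Mills on `T³` — NOT `d = 4`, NOT infinite volume, NOT a mass gap, NOT Clay); width seat `ym-ust-20520-w3` g14;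
helper of the crux `stmt-QuantumFields-20520` (`--supports`, NOT a proof of it).  THEOREMS ONLY (0 `def`, default heartbeats).

WHAT.  The companion of record for `Sfine = histGood F 𝓔 θ K J` is its CLOSURE `H̄ := closure histGood` (closed; inside the `≤`-profile set by
✓`closure_histProfile_subset_and_continuousAt`; hence inside the chart-window set and with STRICT small loop history once `((d+2)L)²/4 · δ₀ < α` for a bound
`θ < δ₀`; its frontier lies on the exact threshold levels by ✓`frontier_histGood_subset`).  Given the `descendTo` chart data of ✓V-c1
`exists_chartData_descendTo_carrier` (entering as HYPOTHESES, T3 currency), this file proves: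
* (the facts on `H̄` and the null row ★★`null_row_of_levelFlat` of V-c1's `map_Φ` are ✓V-c2a `…ChartContClosedProfile`);
* §3 ★★★ `exists_windowChart_of_carrierData` — a `WindowChart F hJK histGood O` (✓`WindowChart.ofLevelAvoiding`: `regular` from ✓`edgeFlat` + ✓`levelFlat`,
  `charge` from ✓`chartCharge`) WHOSE `Φ`, `jac` ARE the given closed-profile chart data — so the carrier rows (14)–(19) of V-c1 speak about THIS `c`;
* §4 ★★★ `exists_windowChart_cont` — the hypothesis-free instantiation on ✓IV-c `exists_fibredChart_iter_cont_blind` in the regime of ✓`windowChartsExist_of_flat`: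
  for every `L, b₀, p₀` a `γ₁`, and for every family, coupling, `J ≤ K` the window `O = {PlaqSmall (θBal J)}` carries a window chart `c` with: compact carriers
  `{c.jac (V,·) ≠ 0}`, `ContinuousOn (c.Φ (V,·)) ∕ (c.jac (V,·))` there, pivot blindness of `T ∕ c.jac ∕ c.Φ`, the recognition clauses, and «fibre points of `H̄`
  are charted to themselves with live Jacobian» (EXW's `σ 0`).
HONEST SCOPE.  Assembly; LAPLACE ∕ S2β ∕ crux 20520 NOT proved; `YM3TorusSU2`
NOT proved; the Yang–Mills mass gap (Clay) NOT proved.  [cite: Balaban1987RG1, (0.4) p.253, (2.4) p.266 and (2.10) p.267] [cite: Balaban1985UV3, (7) p.257]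
-/

noncomputable section

open MeasureTheory Filter Topology Set
open scoped ENNReal NNReal
open Literature.MathematicalPhysics.QuantumFieldTheory.Balaban1983to89
open Literature.MathematicalPhysics.QuantumFieldTheory.Balaban1983to89.T3ContinuumYM3Torus
open Literature.MathematicalPhysics.QuantumFieldTheory.Balaban1983to89.T3UnitLawDensityEML
open Literature.MathematicalPhysics.QuantumFieldTheory.Balaban1983to89.T3UnitScaleTilt
open Literature.MathematicalPhysics.QuantumFieldTheory.Balaban1983to89.T3TiltDescent
open Literature.MathematicalPhysics.QuantumFieldTheory.Balaban1983to89.T3LevelShift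
open Literature.MathematicalPhysics.QuantumFieldTheory.Balaban1983to89.T3Thresholds
open Literature.MathematicalPhysics.QuantumFieldTheory.Balaban1983to89.T4Continuum
open scoped Literature.MathematicalPhysics.QuantumFieldTheory.Balaban1983to89.T3OrbitAverage

namespace Summit.QuantumFields.YangMills.Theorems.FluctuationComparisonRegPrIntLS2BetaChartContWindowChart

open Summit.QuantumFields.YangMills.Theorems.FluctuationComparisonRegPrIntLWregChain
open Summit.QuantumFields.YangMills.Theorems.FluctuationComparisonRegPrIntLWregFibredChart
open Summit.QuantumFields.YangMills.Theorems.FluctuationComparisonRegPrIntLWregGlue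
open Summit.QuantumFields.YangMills.Theorems.FluctuationComparisonRegPrIntLWregInterior
open Summit.QuantumFields.YangMills.Theorems.FluctuationComparisonRegPrIntLWregAssembly
open Summit.QuantumFields.YangMills.Theorems.FluctuationComparisonRegPrIntLS2BetaChartContDescend
open Summit.QuantumFields.YangMills.Theorems.FluctuationComparisonRegPrIntLS2BetaChartContClosedProfile
open Function
open Literature.MathematicalPhysics.QuantumFieldTheory.Balaban1983to89.BlockAveraging (Idx loopHol)
open Literature.MathematicalPhysics.QuantumFieldTheory.Balaban1983to89.BlockAveragingEMLHaarAC (offCard)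
open Literature.MathematicalPhysics.QuantumFieldTheory.Balaban1983to89.ExpMeanLog (deltaSU)
open Literature.MathematicalPhysics.QuantumFieldTheory.Balaban1983to89.LatticeWordStokes (dist1_loopHol_le)

/-! ## §3 The window chart of record from closed-profile chart data -/

/-- ★★★ **THE WINDOW CHART OF RECORD**: closed-profile `descendTo` chart data on `histGood` with companion `closure histGood` (the conjuncts of ✓V-c1 that this step
uses, as hypotheses) yield a `WindowChart F hJK histGood O` on the window `O = {PlaqSmall (θ J)}` whose chart map and Jacobian ARE the given ones — `map_Φ` by the
null row (§2), `regular` by ✓`edgeFlat` + ✓`levelFlat` through ✓`WindowChart.ofLevelAvoiding`, `charge` by ✓`chartCharge` through `recog`.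
[cite: Balaban1987RG1, (2.10) p.267] [cite: Balaban1985UV3, (7) p.257] -/
theorem exists_windowChart_of_carrierData (F : T3Family) {J K : ℕ} (hJK : J ≤ K) {θ : ℕ → ℝ} (hθpos : ∀ i, 0 < θ i) {δ₀ α : ℝ} (hδ₀ : 0 ≤ δ₀)
    (hθ : ∀ i, θ i < δ₀) (hsmall : (((((F.P K).d + 2) * (F.P K).L : ℕ) : ℝ) ^ 2 / 4) * δ₀ ≤ ExpMeanLog.deltaSU (Fin 2) / 2)
    (hD : (((((F.P K).d + 2) * (F.P K).L : ℕ) : ℝ) ^ 2 / 4) * δ₀ < α)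
    (hα0 : 0 < α) (hα24 : α ≤ 1 / 24) (hα64 : 64 * α ≤ deltaSU (Fin 2)) (hαL : 157 * α < (((F.P K).L : ℝ) ^ ((F.P K).d - 1))⁻¹)
    (hgap : ∀ j (c : PBond (F.P K) (j + 1)), (offCard c : ℝ) / (Fintype.card (Idx (F.P K)) : ℝ) + 150 * α < 1)
    {Φ : GaugeField (F.P J) 0 (Matrix.specialUnitaryGroup (Fin 2) ℂ) × GaugeField (F.P K) 0 (Matrix.specialUnitaryGroup (Fin 2) ℂ) →
      GaugeField (F.P K) 0 (Matrix.specialUnitaryGroup (Fin 2) ℂ)}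
    {jac : GaugeField (F.P J) 0 (Matrix.specialUnitaryGroup (Fin 2) ℂ) × GaugeField (F.P K) 0 (Matrix.specialUnitaryGroup (Fin 2) ℂ) → ℝ≥0}
    {T : PBond (F.P K) (K - J) → GaugeField (F.P K) 0 (Matrix.specialUnitaryGroup (Fin 2) ℂ) → Set (Matrix.specialUnitaryGroup (Fin 2) ℂ)}
    {w : PBond (F.P K) (K - J) → PBond (F.P J) 0}
    (hΦm : Measurable Φ) (hjm : Measurable jac)
    (hfib : ∀ V z, jac (V, z) ≠ 0 → descendTo F ℰp J K hJK (Φ (V, z)) = V)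
    (hlaw : ∀ O : Set (GaugeField (F.P J) 0 (Matrix.specialUnitaryGroup (Fin 2) ℂ)), MeasurableSet O →
      (∀ V ∈ O, ∀ᵐ z ∂fieldMeasure (F.P K) 0 (Matrix.specialUnitaryGroup (Fin 2) ℂ), jac (V, z) ≠ 0 → Φ (V, z) ∈ histGood F ℰp θ K J) →
      (fieldMeasure (F.P K) 0 (Matrix.specialUnitaryGroup (Fin 2) ℂ)).restrict (descendTo F ℰp J K hJK ⁻¹' O ∩ histGood F ℰp θ K J) =
        ((((fieldMeasure (F.P J) 0 (Matrix.specialUnitaryGroup (Fin 2) ℂ)).restrict O).prod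
          (fieldMeasure (F.P K) 0 (Matrix.specialUnitaryGroup (Fin 2) ℂ))).withDensity fun p => (jac p : ℝ≥0∞)).map Φ)
    (hne : ∀ V z, jac (V, z) ≠ 0 ↔ (∀ c, V (w c) ∈ T c z) ∧ Φ (V, z) ∈ closure (histGood F ℰp θ K J))
    (hcont : ∀ V₀ z, (∀ c, V₀ (w c) ∈ interior (T c z)) → Φ (V₀, z) ∉ frontier (closure (histGood F ℰp θ K J)) →
      ContinuousAt (fun V => Φ (V, z)) V₀ ∧ ContinuousAt (fun V => jac (V, z)) V₀)
    (hdead : ∀ V₀ z, (∃ c, V₀ (w c) ∉ closure (T c z)) → ∀ᶠ V in 𝓝 V₀, jac (V, z) = 0)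
    (hTc : ∀ c z, IsClosed (T c z))
    (hTeq : ∀ c z, T c z = chainMap ℰp (K - J) z c '' chainWindow (N := 2) α (K - J) z c)
    (hcharted : ∀ V z, (∀ c, V (w c) ∈ T c z) → (∀ b, (∀ c, iterCentralBond (K - J) c ≠ b) → Φ (V, z) b = z b) ∧
      (∀ c, Φ (V, z) (iterCentralBond (K - J) c) ∈ chainWindow (N := 2) α (K - J) (Φ (V, z)) c) ∧
      descendTo F ℰp J K hJK (Φ (V, z)) = V)
    {bound : ℝ≥0} (hbdd : ∀ p, jac p ≤ bound)
    (hrecog : ∀ V z (g : PBond (F.P K) (K - J) → Matrix.specialUnitaryGroup (Fin 2) ℂ), (∀ c, g c ∈ chainWindow (N := 2) α (K - J) z c) →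
      Function.extend (iterCentralBond (K - J)) g z ∈ closure (histGood F ℰp θ K J) →
      descendTo F ℰp J K hJK (Function.extend (iterCentralBond (K - J)) g z) = V →
      jac (V, z) ≠ 0 ∧ Φ (V, z) = Function.extend (iterCentralBond (K - J)) g z) :
    ∃ c : WindowChart F hJK (histGood F ℰp θ K J) {V | PlaqSmall (θ J) V}, c.Φ = Φ ∧ c.jac = jac := by
  have hn : K - J ≤ (F.P K).m + (F.P K).K := by
    show K - J ≤ F.m + K
    omega
  have hβ := iterCentralBond_injective (P := F.P K) (n := K - J) hn
  have hθ0 : ∀ i, 0 ≤ θ i := fun i => (hθpos i).le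
  have hs := F.sitesPerDir_eq (m := F.m) (K := J) (j := 0) (m' := F.m) (K' := K) (j' := K - J) (by omega)
  have hdesc : (descendTo F ℰp J K hJK : GaugeField (F.P K) 0 (Matrix.specialUnitaryGroup (Fin 2) ℂ) → GaugeField (F.P J) 0 _) =
      fieldShift hs ∘ Averaging.iter (fun i => BlockAveraging.blockAvg (P := F.P K) (j := i) ℰp) (K - J) := rfl
  have he'e : ∀ y : GaugeField (F.P K) (K - J) (Matrix.specialUnitaryGroup (Fin 2) ℂ), fieldShift hs.symm (fieldShift hs y) = y :=
    fieldShift_fieldShift_symm hs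
  have hee' : ∀ y' : GaugeField (F.P J) 0 (Matrix.specialUnitaryGroup (Fin 2) ℂ), fieldShift hs (fieldShift hs.symm y') = y' :=
    fieldShift_symm_fieldShift hs
  have hiter_of_desc : ∀ U V, descendTo F ℰp J K hJK U = V →
      Averaging.iter (fun i => BlockAveraging.blockAvg (P := F.P K) (j := i) ℰp) (K - J) U = fieldShift hs.symm V := by
    intro U V h
    rw [hdesc, Function.comp_apply] at h
    rw [← h, he'e]
  set O : Set (GaugeField (F.P J) 0 (Matrix.specialUnitaryGroup (Fin 2) ℂ)) := {V | PlaqSmall (θ J) V} with hOdef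
  have hO : IsOpen O := isOpen_setOf_plaqSmall₂ (F.P J) 0 (θ J)
  -- the law for `histGood`, its null row discharged by LEVEL flatness
  have hmap := hlaw O hO.measurableSet fun V hV =>
    null_row_of_levelFlat F hJK hθpos hδ₀ hθ hsmall hα0 hα24 hα64 hαL hgap hne hcharted V hV
  refine ⟨WindowChart.ofLevelAvoiding F hJK hδ₀ hθ hsmall O Φ jac bound hΦm hjm hbdd (fun V _ z hj => hfib V z hj) hmap
    (fun V₀ hV₀ => ?level) (fun V₁ _ hpre => ?charge), rfl, rfl⟩
  case level =>
    -- EDGE: a.e. all-interior or some-exterior; LEVEL: a.e. exact levels avoided on live leaves; top level strict on the window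
    have haeE : ∀ c, ∀ᵐ z ∂fieldMeasure (F.P K) 0 (Matrix.specialUnitaryGroup (Fin 2) ℂ),
        V₀ (w c) ∉ frontier (chainMap ℰp (K - J) z c '' chainWindow (N := 2) α (K - J) z c) := fun c =>
      Summit.QuantumFields.YangMills.Theorems.FluctuationComparisonRegPrIntLWreg.edgeFlat F K (K - J) hn α hα0 hα24 hα64 hαL hgap c (V₀ (w c))
    have haeL := Summit.QuantumFields.YangMills.Theorems.FluctuationComparisonRegPrIntLWreg.levelFlat F K (K - J) hn α hα0 hα24 hα64 hαL hgap
      (fun j => θ (K - j)) (fun j => (hθpos _).ne') (fieldShift hs.symm V₀)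
    filter_upwards [ae_all_iff.2 haeE, haeL] with z hzE hzL
    by_cases hT : ∀ c, V₀ (w c) ∈ T c z
    · -- all pivot coordinates interior (off the frontier and inside the closed window)
      have hint : ∀ c, V₀ (w c) ∈ interior (T c z) := fun c => by
        rw [← self_sdiff_frontier]
        refine ⟨hT c, ?_⟩
        rw [hTeq]
        exact hzE c
      obtain ⟨hoff, hwin, hd⟩ := hcharted V₀ z hT
      have h2 := hiter_of_desc _ _ hd
      have hlev : ∀ j, j ≤ K - J → ∀ p : Plaq (F.P K) j,
          dist1 (GaugeField.plaqHol (Averaging.iter (fun i => BlockAveraging.blockAvg (P := F.P K) (j := i) ℰp) j (Φ (V₀, z))) p) ≠ θ (K - j) := by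
        intro j hj p
        rcases hj.lt_or_eq with hlt | rfl
        · exact hzL (Φ (V₀, z)) hoff hwin h2 j hlt p
        · rw [h2, Nat.sub_sub_self hJK]
          exact (lt_of_eq_of_lt (congrArg dist1 (plaqHol_fieldShift hs.symm V₀ p)) (hV₀ _)).ne
      have hfr : Φ (V₀, z) ∉ frontier (closure (histGood F ℰp θ K J)) := fun h => by
        obtain ⟨j, hj, p, hp⟩ := frontier_closure_histGood_subset F hJK hδ₀ hθ hsmall h
        exact hlev j hj p hp
      obtain ⟨hΦc, hjc⟩ := hcont V₀ z hint hfr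
      exact Or.inl ⟨NNReal.continuous_coe.continuousAt.comp hjc, hΦc, fun _ => hlev⟩
    · simp only [not_forall] at hT
      obtain ⟨c, hc⟩ := hT
      have hout : ∃ c, V₀ (w c) ∉ closure (T c z) := ⟨c, by rwa [(hTc c z).closure_eq]⟩
      exact Or.inr ((hdead V₀ z hout).mono fun V h => Or.inl h)
  case charge =>
    obtain ⟨U₀, hU₀V, hU₀int⟩ := hpre
    have hW := hiter_of_desc _ _ hU₀V
    have hθα : ∀ i, (((((F.P K).d + 2) * (F.P K).L : ℕ) : ℝ) ^ 2 / 4) * θ i ≤ α := fun i => by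
      have h5 : (0 : ℝ) ≤ ((((F.P K).d + 2) * (F.P K).L : ℕ) : ℝ) ^ 2 / 4 := by positivity
      exact (mul_le_mul_of_nonneg_left (hθ i).le h5).trans hD.le
    have hpos := Summit.QuantumFields.YangMills.Theorems.FluctuationComparisonRegPrIntLWreg.chartCharge F K J θ α hθ0 hα0 hα24 hα64 hαL hgap hθα
      (fieldShift hs.symm V₁) ⟨U₀, hU₀int, hW⟩
    refine hpos.trans_le (measure_mono ?_)
    rintro z ⟨g, hUgood, hUiter⟩
    have hch : ∀ c, g c ∈ chainWindow (N := 2) α (K - J) z c := fun c => by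
      have h := histGood_subset_charted F hJK hθ0 hθα hUgood c
      rwa [hβ.extend_apply, chainWindow_extend α hn] at h
    have hd : descendTo F ℰp J K hJK (Function.extend (iterCentralBond (K - J)) g z) = V₁ := by
      rw [hdesc, Function.comp_apply, hUiter, hee']
    obtain ⟨hJ, hΦ⟩ := hrecog V₁ z g hch (subset_closure hUgood) hd
    exact ⟨hJ, hΦ ▸ hUgood⟩

/-! ## §4 The hypothesis-free instantiation on CHART∞ IV-c -/

/-- ★★★ **THE WINDOW CHART OF RECORD WITH ITS CARRIER ROWS, HYPOTHESIS-FREE** — in the regime of ✓`windowChartsExist_of_flat` (chart level `α(L)` of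
✓`exists_chartRegime`, thresholds `θBal ≤ α/(D₅+1)`), the continuous pivot-blind fibred chart ✓IV-c `exists_fibredChart_iter_cont_blind`, transported by ✓V-c1 with
companion `closure histGood` and assembled by §3: on the window `O = {PlaqSmall (θBal J)}` a `WindowChart` whose carriers `{c.jac (V,·) ≠ 0}` are compact, carry the
continuity of `c.Φ (V,·)` and `c.jac (V,·)`, are pivot-blind, and contain every fibre point of `closure histGood` charted to itself with live Jacobian; plus the
live-point characterisation, the `charted` clause and the recognition clause.  (The residual-gauge half of LIMIT-INST's invariance rows is CHART∞ V-b.)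
[cite: Balaban1987RG1, (0.4) p.253, (2.4) p.266 and (2.10) p.267] [cite: Balaban1985UV3, (7) p.257] -/
theorem exists_windowChart_cont :
    ∀ (L : ℕ) (b₀ p₀ : ℝ), 0 < b₀ → 0 < p₀ → ∃ γ₁ : ℝ, 0 < γ₁ ∧ ∀ (F : T3Family) (γ : ℝ), F.L = L → 0 < γ → γ ≤ γ₁ →
      ∀ (J K : ℕ) (hJK : J ≤ K),
        ∃ (c : WindowChart F hJK (histGood F ℰp (θBal F.L γ b₀ p₀) K J) {V | PlaqSmall (θBal F.L γ b₀ p₀ J) V})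
          (T : PBond (F.P K) (K - J) → GaugeField (F.P K) 0 (Matrix.specialUnitaryGroup (Fin 2) ℂ) → Set (Matrix.specialUnitaryGroup (Fin 2) ℂ))
          (w : PBond (F.P K) (K - J) → PBond (F.P J) 0),
          (∀ V z, c.jac (V, z) ≠ 0 → descendTo F ℰp J K hJK (c.Φ (V, z)) = V) ∧
          (∀ V z, c.jac (V, z) ≠ 0 ↔ (∀ c', V (w c') ∈ T c' z) ∧ c.Φ (V, z) ∈ closure (histGood F ℰp (θBal F.L γ b₀ p₀) K J)) ∧
          (∀ V, IsCompact {z | c.jac (V, z) ≠ 0}) ∧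
          (∀ V, ContinuousOn (fun z => c.Φ (V, z)) {z | c.jac (V, z) ≠ 0} ∧ ContinuousOn (fun z => c.jac (V, z)) {z | c.jac (V, z) ≠ 0}) ∧
          (∀ c' z (g : PBond (F.P K) (K - J) → Matrix.specialUnitaryGroup (Fin 2) ℂ), T c' (Function.extend (iterCentralBond (K - J)) g z) = T c' z) ∧
          (∀ V z (g : PBond (F.P K) (K - J) → Matrix.specialUnitaryGroup (Fin 2) ℂ), c.jac (V, Function.extend (iterCentralBond (K - J)) g z) = c.jac (V, z)) ∧
          (∀ V z (g : PBond (F.P K) (K - J) → Matrix.specialUnitaryGroup (Fin 2) ℂ), c.jac (V, z) ≠ 0 →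
            c.Φ (V, Function.extend (iterCentralBond (K - J)) g z) = c.Φ (V, z)) ∧
          (∀ V U, descendTo F ℰp J K hJK U = V → U ∈ closure (histGood F ℰp (θBal F.L γ b₀ p₀) K J) → c.jac (V, U) ≠ 0 ∧ c.Φ (V, U) = U) ∧
          (∀ V z, (∀ c', V (w c') ∈ T c' z) → (∀ b, (∀ c', iterCentralBond (K - J) c' ≠ b) → c.Φ (V, z) b = z b) ∧
            descendTo F ℰp J K hJK (c.Φ (V, z)) = V) ∧
          (∀ (u : GaugeTransf (F.P K) 0 (Matrix.specialUnitaryGroup (Fin 2) ℂ)),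
            (∀ V' : GaugeField (F.P K) (K - J) (Matrix.specialUnitaryGroup (Fin 2) ℂ), GaugeField.gaugeAct (transfUp u (K - J)) V' = V') →
            ∀ V z, c.jac (V, GaugeField.gaugeAct u z) = c.jac (V, z) ∧
              (c.jac (V, z) ≠ 0 → c.Φ (V, GaugeField.gaugeAct u z) = GaugeField.gaugeAct u (c.Φ (V, z)))) ∧
          (∀ V U, descendTo F ℰp J K hJK U = V → U ∈ histGood F ℰp (θBal F.L γ b₀ p₀) K J → {z | c.jac (V, z) ≠ 0} ∈ 𝓝 U) ∧
          (∀ V z U', U' ∈ closure (histGood F ℰp (θBal F.L γ b₀ p₀) K J) → descendTo F ℰp J K hJK U' = V →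
            (∀ b, (∀ c', iterCentralBond (K - J) c' ≠ b) → U' b = z b) → c.jac (V, z) ≠ 0 ∧ c.Φ (V, z) = U') := by
  intro L b₀ p₀ hb hp
  by_cases hL : 1 ≤ L
  swap
  · refine ⟨1, one_pos, fun F γ hFL _ _ => ?_⟩
    exact absurd (hFL ▸ F.hL.2.le) hL
  obtain ⟨α, hα0, hα24, hα64, hαF⟩ := exists_chartRegime L hL
  set D₅ : ℝ := ((((3 + 2) * L : ℕ) : ℝ) ^ 2 / 4) with hD₅
  have hD₅0 : 0 ≤ D₅ := by positivity
  set σ : ℝ := α / (D₅ + 1) with hσ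
  have hσ0 : 0 < σ := div_pos hα0 (by positivity)
  set δ₀ : ℝ := α / (D₅ + 1 / 2) with hδ₀def
  have hδ₀0 : 0 < δ₀ := div_pos hα0 (by positivity)
  have hσδ : σ < δ₀ := by
    rw [hσ, hδ₀def]
    exact div_lt_div_of_pos_left hα0 (by positivity) (by linarith)
  have hDδ : D₅ * δ₀ < α := by
    rw [hδ₀def, mul_div_assoc', div_lt_iff₀ (by positivity)]
    nlinarith [hα0]
  obtain ⟨γ₂, hγ₂, hγ₂1, hθσ⟩ := exists_gamma_forall_θBal_le (b₀ := b₀) (p₀ := p₀) hb hp hσ0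
  refine ⟨γ₂, hγ₂, fun F γ hFL hγ hγle J K hJK => ?_⟩
  haveI : BorelSpace (GaugeField (F.P K) 0 (Matrix.specialUnitaryGroup (Fin 2) ℂ)) :=
    inferInstanceAs (BorelSpace (PBond (F.P K) 0 → Matrix.specialUnitaryGroup (Fin 2) ℂ))
  have hLF : 1 ≤ F.L := F.hL.2.le
  obtain ⟨hαL, hgap⟩ := hαF F hFL K
  have hγ1 : γ ≤ 1 := hγle.trans hγ₂1
  have hθpos : ∀ i, 0 < θBal F.L γ b₀ p₀ i := fun i => T3MinimiserStabilityReduction.θBal_pos hLF hγ hγ1 hb p₀ i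
  have hd : (F.P K).d = 3 := T3Family.P_d F K
  have hLL : (F.P K).L = L := hFL
  have hD₅eq : (((((F.P K).d + 2) * (F.P K).L : ℕ) : ℝ) ^ 2 / 4) = D₅ := by rw [hd, hLL]
  have hθδ : ∀ i, θBal F.L γ b₀ p₀ i < δ₀ := fun i => (hθσ F.L hLF γ hγ hγle i).trans_lt hσδ
  have hsmall : (((((F.P K).d + 2) * (F.P K).L : ℕ) : ℝ) ^ 2 / 4) * δ₀ ≤ ExpMeanLog.deltaSU (Fin 2) / 2 := by
    rw [hD₅eq]; nlinarith [hDδ, hα64, ExpMeanLog.deltaSU_pos (n := Fin 2)]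
  have hD : (((((F.P K).d + 2) * (F.P K).L : ℕ) : ℝ) ^ 2 / 4) * δ₀ < α := by rw [hD₅eq]; exact hDδ
  have hαδ : α < deltaSU (Fin 2) := by nlinarith [ExpMeanLog.deltaSU_pos (n := Fin 2)]
  have hn : K - J ≤ (F.P K).m + (F.P K).K := by
    show K - J ≤ F.m + K
    omega
  have hβ := iterCentralBond_injective (P := F.P K) (n := K - J) hn
  set θ := θBal F.L γ b₀ p₀ with hθdef
  -- CHART-VOL for the Jacobian bound, then the continuous pivot-blind chart (IV-c) and its transport (V-c1)
  obtain ⟨j₀, hj₀, hvol⟩ := Summit.QuantumFields.YangMills.Theorems.FluctuationComparisonRegPrIntLWreg.chartVol F K α hα0 hα24 hα64 hαL hgap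
  obtain ⟨Φ, Jac, T, hΦm, hJm, hfib, hlaw, hTc, hJT, hreg, hdead, hTeq, hcharted, hbdd, hrecog, -, -, -, hTbl, hΦbl, hJbl, htransfer⟩ :=
    Summit.QuantumFields.YangMills.Theorems.FluctuationComparisonRegPrIntLS2BetaChartContBlindFibredChart.exists_fibredChart_iter_cont_blind
      (N := 2) (P := F.P K) hα0.le hα24 hα64 hαL hgap (Or.inr hvol) hn
  have hSm : MeasurableSet (histGood F ℰp θ K J) := measurableSet_histGood F ℰp measurableE_ℰp θ K J
  have hHcl : IsClosed (closure (histGood F ℰp θ K J)) := isClosed_closure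
  -- gauge covariance of the generic chart (V-b1 ∕ V-b2) and gauge invariance of the companion
  have hcovΦ := fun (u : GaugeTransf (F.P K) 0 (Matrix.specialUnitaryGroup (Fin 2) ℂ)) V z (hJ : Jac (V, z) ≠ 0) =>
    Summit.QuantumFields.YangMills.Theorems.FluctuationComparisonRegPrIntLS2BetaChartContCovariance.chart_gaugeAct
      (N := 2) (P := F.P K) hn hfib hJT hcharted hrecog u V z hJ
  have hcovJ := fun (u : GaugeTransf (F.P K) 0 (Matrix.specialUnitaryGroup (Fin 2) ℂ)) V z (hJ : Jac (V, z) ≠ 0) hstrict =>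
    Summit.QuantumFields.YangMills.Theorems.FluctuationComparisonRegPrIntLS2BetaChartContCovariancePointwise.jac_gaugeAct_eq_of_live
      (N := 2) (P := F.P K) hαδ hn hΦm hJm hfib hlaw hJT hcharted hrecog htransfer hTbl hΦbl hJbl u V z hJ hstrict
  have hHg : ∀ (u : GaugeTransf (F.P K) 0 (Matrix.specialUnitaryGroup (Fin 2) ℂ)) U,
      GaugeField.gaugeAct u U ∈ closure (histGood F ℰp θ K J) ↔ U ∈ closure (histGood F ℰp θ K J) := by
    have key : ∀ (v : GaugeTransf (F.P K) 0 (Matrix.specialUnitaryGroup (Fin 2) ℂ)) W, W ∈ closure (histGood F ℰp θ K J) →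
        GaugeField.gaugeAct v W ∈ closure (histGood F ℰp θ K J) := fun v W hW =>
      map_mem_closure (Summit.QuantumFields.YangMills.Theorems.FluctuationComparisonRegPrIntLS2BetaChartContCovariancePointwise.continuous_gaugeAct v)
        hW fun x hx => (Summit.QuantumFields.YangMills.Theorems.FluctuationComparisonRegPrIntLS2BetaResidualGauge.gaugeAct_mem_histGood_iff F v θ J x).2 hx
    intro u U
    refine ⟨fun h => ?_, key u U⟩
    have h' := key (fun x => (u x)⁻¹) _ h
    rwa [Summit.QuantumFields.YangMills.Theorems.FluctuationComparisonRegPrIntLS2BetaChartContCovariance.gaugeAct_inv_gaugeAct] at h'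
  have hgraph := fun (U₀ : GaugeField (F.P K) 0 (Matrix.specialUnitaryGroup (Fin 2) ℂ)) hstrict =>
    Summit.QuantumFields.YangMills.Theorems.FluctuationComparisonRegPrIntLS2BetaChartContCarrierNhds.graph_mem_nhds (N := 2) (P := F.P K)
      hα24 hαδ hαL hn hJT hrecog U₀ hstrict
  have hSo : IsOpen (histGood F ℰp θ K J) := isOpen_histGood F hδ₀0.le (fun i => (hθδ i).le) hsmall hJK
  obtain ⟨Φ', jac, w, hΦ'm, hjm, hfib', -, hlaw', hTc', hne, hcont, hdead', hTeq', hcharted', hbdd', hrecog', hcompact, hcontOn, hTbl', hjbl, hΦbl',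
      hself, hcov, hnhds⟩ :=
    exists_chartData_descendTo_carrier (N := 2) F hJK hαδ hΦm hJm hfib hlaw hTc hJT hreg hdead hTeq hcharted hbdd hrecog htransfer hTbl hΦbl hJbl
      hcovΦ hcovJ hgraph hSm hHcl.measurableSet subset_closure (closure_histGood_subset_charted F hJK hδ₀0.le hθδ hsmall hD) hHcl
      (closure_histGood_subset_loopSmall_lt F hJK hδ₀0.le hθδ hsmall hD) hHg hSo
  -- the window chart of record (§3)
  have hq : j₀ ^ ((K - J) * Fintype.card (PBond (F.P K) (K - J))) ≠ 0 := pow_ne_zero _ hj₀.ne'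
  have hbddinv : ∀ p, jac p ≤ (j₀ ^ ((K - J) * Fintype.card (PBond (F.P K) (K - J))))⁻¹ := fun p => by
    rw [NNReal.le_inv_iff_mul_le hq, mul_comm]
    exact hbdd' p
  obtain ⟨c, hcΦ, hcjac⟩ := exists_windowChart_of_carrierData F hJK hθpos hδ₀0.le hθδ hsmall hD hα0 hα24 hα64 hαL hgap hΦ'm hjm hfib' hlaw' hne
    hcont hdead' hTc' hTeq' hcharted' hbddinv hrecog'
  -- recognition of ANY closed-profile fibre field with the off-pivot coordinates of `z` (α-free form)
  have hrecogF : ∀ V z U', U' ∈ closure (histGood F ℰp θ K J) → descendTo F ℰp J K hJK U' = V →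
      (∀ b, (∀ c', iterCentralBond (K - J) c' ≠ b) → U' b = z b) → jac (V, z) ≠ 0 ∧ Φ' (V, z) = U' := by
    intro V z U' hU' hd hoff
    have hext : Function.extend (iterCentralBond (K - J)) (fun c' => U' (iterCentralBond (K - J) c')) z = U' := by
      funext b
      by_cases hb : ∃ c', iterCentralBond (K - J) c' = b
      · obtain ⟨c', rfl⟩ := hb
        exact hβ.extend_apply _ _ _
      · rw [Function.extend_apply' _ _ _ hb]
        exact (hoff b fun c' hc => hb ⟨c', hc⟩).symm
    have hg : ∀ c', U' (iterCentralBond (K - J) c') ∈ chainWindow (N := 2) α (K - J) z c' := fun c' => by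
      have h := closure_histGood_subset_charted F hJK hδ₀0.le hθδ hsmall hD hU' c'
      rwa [← hext, hβ.extend_apply, chainWindow_extend α hn] at h
    have h := hrecog' V z (fun c' => U' (iterCentralBond (K - J) c')) hg (by rw [hext]; exact hU') (by rw [hext]; exact hd)
    rw [hext] at h
    exact h
  refine ⟨c, T, w, ?_, ?_, ?_, ?_, hTbl', ?_, ?_, ?_, ?_, ?_, ?_, ?_⟩ <;> simp only [hcΦ, hcjac]
  · exact hfib'
  · exact hne
  · exact hcompact
  · exact hcontOn
  · exact hjbl
  · exact hΦbl'
  · exact hself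
  · exact fun V z hV => ⟨(hcharted' V z hV).1, (hcharted' V z hV).2.2⟩
  · exact hcov
  · exact hnhds
  · exact hrecogF

end Summit.QuantumFields.YangMills.Theorems.FluctuationComparisonRegPrIntLS2BetaChartContWindowChart

end
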